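import Mathlib
import Summits.NavierStokesRegularity.NavierStokesRegularity.Theorems.TypeIQuarterGateScarEnvelopeTypeISatelliteTowerDssNecklace

/-!
# Satellite tower for crux `ScarEnvelopeTypeI` (stmt-NavierStokesRegularity-23843) — Part Z5/Z5⁺: in the DSS cell TAME ⟺ LEAF ⟺ GLOBALLY ENVELOPED, WILD ⟺ NECKLACE

Part Z5/Z5⁺ of nsreg-p3 g28's ROUND-44 artefact (`partZ3b.lean`): ★★ `hasTypeIDecay_of_pastDss_leaf`, `pastDss_cell` — for past-DSS rooted objects
TAME ⟺ LEAF ⟺ GLOBALLY ENVELOPED (`HasTypeIDecay`, = Chae–Wolf (1.7) = Pineau–Vicol (1.10)) and WILD ⟺ NECKLACE.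

PROVENANCE: declaration texts VERBATIM from the HOME artefact of the instrument seat nsreg-p3 g27 (cell `pub/ns-regularity-ideate`):
`round-44/Junction44.lean` (sha16 `ec5c26d3f01f4277`, parts `partZ1…partZ7.lean`; a module written against the TREE, importing route
RecurrentProfiles' crux-1589 dynamics modules BY NAME; memo `round-44/ROUND-44.md` c316de8a95807228), scored PASS ★★ by referee ref3 g27
(`SCORE-p3-ROUND-44-0828.md` f10387a6f12e4133); the author cannot write under `Theorems/`
(`perm.theorems-prover-only`); landed by the prover ns-es-p1 g5 as landing hand of record (director-ns DIRECTOR-NS #237 (3)), split into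
≤ 400-line modules, `E3` spelled out, the artefact's `#guard_msgs … #print axioms` certificates not landed.
`--supports stmt-NavierStokesRegularity-23843 --as helper`.

HONEST FRAMING: instrument theorems about HYPOTHETICAL Type-I zoom limits (Albritton–Barker objects of the census of crux
`TypeIQuarterGate.ScarEnvelopeTypeI`, item 23843); the analytic input is the tree's closure engine (compactness
`local_typeI_compactness_twin_inBall`, sharpened to constant 1 in Part S1; Q1 whole-space), P1 rate inheritance, L8 persistence and the
tree's PROVED small-constant Liouville theorem; Parts R/S are order theory on the re-classing and closure lemmas.  NOTHING OPEN IS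
PROVED: 23843, (L′) `TypeILiouvilleAB` / (L′₀), the GLOBAL (S∞) = `CritAttained`, (M𝐈₁), (E1⁺), (E2ᵣ), route ExtremalTypeIConstant's
cruxes, N0 and Navier–Stokes regularity are OPEN; `critRate`, `levelCrit I`, `liouvilleRate` are `sInf`s that are `0` by junk value
when the defining set is empty (every statement using them carries the nonemptiness hypothesis explicitly).
-/

-- the summit-side namespace repeats a component by design (single-conjunct summit, D-0017)
set_option linter.dupNamespace false

open MeasureTheory Set Metric Filter Topology
open scoped ENNReal NNReal InnerProductSpace
open Literature.Analysis.FluidPDE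

namespace Summit.NavierStokesRegularity.NavierStokesRegularity.Cruxes.ScarEnvelopeTypeI.ZoomDictionary

section HullJunction

variable {U U₁ U₂ W : ℝ → (EuclideanSpace ℝ (Fin 3)) → (EuclideanSpace ℝ (Fin 3))}
  {P : ℝ → (EuclideanSpace ℝ (Fin 3)) → ℝ}
  {H : ℝ → (EuclideanSpace ℝ (Fin 3)) → (EuclideanSpace ℝ (Fin 3)) →L[ℝ] (EuclideanSpace ℝ (Fin 3))}
  {M : ℝ}

/-! #### Z5⁺. A past-DSS LEAF is globally enveloped: for DSS objects, TAME ⟺ LEAF and WILD ⟺ NECKLACE -/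

/-- Past-DSS with factor `c` gives past-DSS with every factor `c^k`, `k ∈ ℤ`. -/
theorem pastDss_zpow {c : ℝ} (hc : 0 < c) (h : ∀ t < 0, ∀ x, nsRescale c U t x = U t x) (k : ℤ) :
    ∀ t < 0, ∀ x, nsRescale (c ^ k) U t x = U t x := by
  induction k with
  | zero => intro t ht x; simp [nsRescale_apply]
  | succ k ih =>
      intro t ht x
      have ht' : c ^ 2 * t < 0 := mul_neg_of_pos_of_neg (by positivity) ht
      rw [zpow_add_one₀ hc.ne', nsRescale_mul, nsRescale_apply, ih _ ht', ← nsRescale_apply, h t ht x]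
  | pred k ih =>
      intro t ht x
      have ht' : c⁻¹ ^ 2 * t < 0 := mul_neg_of_pos_of_neg (by positivity) ht
      rw [zpow_sub_one₀ hc.ne', nsRescale_mul, nsRescale_apply, ih _ ht', ← nsRescale_apply,
        pastDss_inv hc h t ht x]

/-- A past-DSS LEAF (`c > 1`) has no satellites at all. -/
theorem regPt_of_pastDss_leaf {n : TNode} {c : ℝ} (hc : 1 < c)
    (h : ∀ t < 0, ∀ x, nsRescale c n.U t x = n.U t x) (hleaf : LeafNode n)
    {y : (EuclideanSpace ℝ (Fin 3))} (hy : y ≠ 0) : RegPt n.U y := by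
  by_contra hny
  exact not_leafNode_of_pastDss_satellite hc h hy hny hleaf

/-- ★★ **Z5⁺. A PAST-DSS LEAF IS GLOBALLY ENVELOPED.**  A rooted-or-not A–B object which is exactly past-DSS
with a factor `c > 1` and has no satellite in the punctured unit ball obeys `‖U(t,x)‖ ≤ A/(‖x‖ + √(-t))`
for every `t < 0` and every `x`.  (Regularity of the compact shell `{(2c)⁻¹ ≤ ‖y‖ ≤ 1}` at the final time
— finitely many `RegPt` cylinders, continuity on the open past — bounds `U` on the fundamental domain
`{c⁻¹ ≤ ‖x‖ + √(-t) ≤ 1}`; past-DSS by `c^ℤ` tiles the past with its rescaled copies.) -/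
theorem hasTypeIDecay_of_pastDss_leaf {n : TNode} (hT : ABTower M n.U n.P n.H) {c : ℝ} (hc : 1 < c)
    (h : ∀ t < 0, ∀ x, nsRescale c n.U t x = n.U t x) (hleaf : LeafNode n) :
    ∃ A : ℝ, HasTypeIDecay A n.U := by
  have hc0 : 0 < c := lt_trans zero_lt_one hc
  have hcont : ContinuousOn (Function.uncurry n.U) (Iio 0 ×ˢ univ) := hT.1.continuousOn_uncurry
  have hreg : ∀ y : (EuclideanSpace ℝ (Fin 3)), y ≠ 0 → RegPt n.U y :=
    fun y hy => regPt_of_pastDss_leaf hc h hleaf hy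
  -- ## the compact shell `K = {(2c)⁻¹ ≤ ‖y‖ ≤ 1}` and its finite cover by regular cylinders
  set K : Set (EuclideanSpace ℝ (Fin 3)) :=
    closedBall (0 : (EuclideanSpace ℝ (Fin 3))) 1 ∩ (ball (0 : (EuclideanSpace ℝ (Fin 3))) (2 * c)⁻¹)ᶜ with hK
  have hKc : IsCompact K := (isCompact_closedBall _ _).inter_right isOpen_ball.isClosed_compl
  have hK0 : ∀ y ∈ K, y ≠ 0 := by
    intro y hy h0
    apply hy.2
    rw [h0]
    exact mem_ball_self (by positivity)
  -- choice of radius and bound at each shell point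
  have hR : ∀ y ∈ K, ∃ r : ℝ, 0 < r ∧ ∃ B : ℝ,
      ∀ z ∈ parabolicCylinder r (((0 : ℝ), y) : ℝ × (EuclideanSpace ℝ (Fin 3))), ‖n.U z.1 z.2‖ ≤ B := by
    intro y hy
    obtain ⟨r, hr, B, hB⟩ := hreg y (hK0 y hy)
    have hQs : parabolicCylinder r (((0 : ℝ), y) : ℝ × (EuclideanSpace ℝ (Fin 3))) ⊆ Iio 0 ×ˢ univ := by
      intro z hz
      rw [mem_parabolicCylinder] at hz
      exact ⟨by simpa using hz.1.2, mem_univ _⟩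
    exact ⟨r, hr, B, norm_le_of_ae_le_of_continuousOn (f := Function.uncurry n.U) (g := fun _ => B)
      (isOpen_parabolicCylinder _ _) (hcont.mono hQs) continuousOn_const hB⟩
  choose! r hr B hB using hR
  obtain ⟨tf, htf⟩ := hKc.elim_nhds_subcover' (fun y _ => ball y (r y)) fun y hy => ball_mem_nhds y (hr y hy)
  -- the shell is nonempty, hence so is the subcover
  obtain ⟨y₁, hy₁⟩ := exists_norm_eq (EuclideanSpace ℝ (Fin 3)) zero_le_one
  have h2c : (2 * c)⁻¹ < 1 := by
    rw [inv_lt_one_iff₀]; right; linarith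
  have hy₁K : y₁ ∈ K := by
    refine ⟨mem_closedBall_zero_iff.2 hy₁.le, fun hb => ?_⟩
    rw [mem_ball_zero_iff, hy₁] at hb
    exact absurd hb (not_lt.2 h2c.le)
  have htne : tf.Nonempty := by
    obtain ⟨i, hi, -⟩ := mem_iUnion₂.1 (htf hy₁K)
    exact ⟨i, hi⟩
  -- ## the uniform radius and the two bounds
  obtain ⟨r₀, hr₀pos, hr₀c, hr₀le⟩ : ∃ r₀ : ℝ, 0 < r₀ ∧ r₀ ≤ (2 * c)⁻¹ ∧
      ∀ i ∈ tf, r₀ ≤ r (i : (EuclideanSpace ℝ (Fin 3))) :=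
    ⟨min (2 * c)⁻¹ (tf.inf' htne fun i => r (i : (EuclideanSpace ℝ (Fin 3)))),
      lt_min (by positivity) ((Finset.lt_inf'_iff _).2 fun i _ => hr _ i.2), min_le_left _ _,
      fun i hi => (min_le_right _ _).trans (Finset.inf'_le _ hi)⟩
  obtain ⟨B₀, hB₀le⟩ : ∃ B₀ : ℝ, ∀ i ∈ tf, B (i : (EuclideanSpace ℝ (Fin 3))) ≤ B₀ :=
    ⟨tf.sup' htne fun i => B (i : (EuclideanSpace ℝ (Fin 3))),
      fun i hi => Finset.le_sup' (fun i : ↥K => B (i : (EuclideanSpace ℝ (Fin 3)))) hi⟩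
  -- the interior compact block `[-1, -r₀²] × B̄₁(0)`
  have hCc : IsCompact (Icc (-1 : ℝ) (-(r₀ ^ 2)) ×ˢ closedBall (0 : (EuclideanSpace ℝ (Fin 3))) 1) :=
    isCompact_Icc.prod (isCompact_closedBall _ _)
  have hCs : Icc (-1 : ℝ) (-(r₀ ^ 2)) ×ˢ closedBall (0 : (EuclideanSpace ℝ (Fin 3))) 1 ⊆ Iio 0 ×ˢ univ := by
    refine prod_mono (fun t ht => ?_) (subset_univ _)
    exact lt_of_le_of_lt ht.2 (neg_neg_of_pos (by positivity))
  obtain ⟨B₁, hB₁⟩ := hCc.exists_bound_of_continuousOn (hcont.mono hCs)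
  obtain ⟨Bm, hBm0, hBm1, hBm2⟩ : ∃ Bm : ℝ, 0 ≤ Bm ∧ B₀ ≤ Bm ∧ B₁ ≤ Bm :=
    ⟨max 0 (max B₀ B₁), le_max_left _ _, (le_max_left _ _).trans (le_max_right _ _),
      (le_max_right _ _).trans (le_max_right _ _)⟩
  -- ## the bound on the fundamental domain `{c⁻¹ ≤ ‖x‖ + √(-t) ≤ 1}`
  have hD : ∀ t < 0, ∀ x : (EuclideanSpace ℝ (Fin 3)), c⁻¹ ≤ ‖x‖ + Real.sqrt (-t) →
      ‖x‖ + Real.sqrt (-t) ≤ 1 → ‖n.U t x‖ ≤ Bm := by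
    intro t ht x hlo hhi
    have hx1 : ‖x‖ ≤ 1 := by linarith [Real.sqrt_nonneg (-t)]
    by_cases ht0 : -(r₀ ^ 2) < t
    · -- near the final time: `x` lies in the shell
      have hst : Real.sqrt (-t) < r₀ := by
        calc Real.sqrt (-t) < Real.sqrt (r₀ ^ 2) :=
              Real.sqrt_lt_sqrt (neg_pos.2 ht).le (by linarith)
          _ = r₀ := Real.sqrt_sq hr₀pos.le
      have hc2 : c⁻¹ = 2 * (2 * c)⁻¹ := by field_simp
      have hxK : x ∈ K := by
        refine ⟨mem_closedBall_zero_iff.2 hx1, fun hb => ?_⟩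
        rw [mem_ball_zero_iff] at hb
        linarith
      obtain ⟨i, hi, hxi⟩ := mem_iUnion₂.1 (htf hxK)
      have hz : ((t, x) : ℝ × (EuclideanSpace ℝ (Fin 3))) ∈
          parabolicCylinder (r (i : (EuclideanSpace ℝ (Fin 3)))) (((0 : ℝ), (i : (EuclideanSpace ℝ (Fin 3)))) :
            ℝ × (EuclideanSpace ℝ (Fin 3))) := by
        rw [mem_parabolicCylinder]
        refine ⟨⟨?_, by simpa using ht⟩, by simpa [dist_eq_norm] using hxi⟩
        have h1 : r₀ ^ 2 ≤ r (i : (EuclideanSpace ℝ (Fin 3))) ^ 2 :=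
          pow_le_pow_left₀ hr₀pos.le (hr₀le i hi) 2
        simp only
        linarith
      have hb := hB _ i.2 _ hz
      calc ‖n.U t x‖ ≤ B (i : (EuclideanSpace ℝ (Fin 3))) := hb
        _ ≤ B₀ := hB₀le i hi
        _ ≤ Bm := hBm1
    · -- away from the final time: the compact block
      push Not at ht0
      have hmt : -t ≤ 1 := by
        have hs1 : Real.sqrt (-t) ≤ 1 := by linarith [norm_nonneg x]
        have := pow_le_one₀ (Real.sqrt_nonneg (-t)) hs1 (n := 2)
        rwa [Real.sq_sqrt (neg_pos.2 ht).le] at this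
      have hz : ((t, x) : ℝ × (EuclideanSpace ℝ (Fin 3))) ∈
          Icc (-1 : ℝ) (-(r₀ ^ 2)) ×ˢ closedBall (0 : (EuclideanSpace ℝ (Fin 3))) 1 :=
        ⟨⟨by linarith, ht0⟩, mem_closedBall_zero_iff.2 hx1⟩
      calc ‖n.U t x‖ = ‖Function.uncurry n.U (t, x)‖ := rfl
        _ ≤ B₁ := hB₁ _ hz
        _ ≤ Bm := hBm2
  -- ## tiling the past by the rescaled fundamental domains
  refine ⟨Bm, fun t ht x => ?_⟩
  set ρ : ℝ := ‖x‖ + Real.sqrt (-t) with hρ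
  have hρ0 : 0 < ρ := add_pos_of_nonneg_of_pos (norm_nonneg _) (Real.sqrt_pos.2 (neg_pos.2 ht))
  set s : ℝ := -Real.log ρ / Real.log c with hs
  set k : ℤ := ⌊s⌋ with hk
  have hlogc : 0 < Real.log c := Real.log_pos hc
  have hcs : c ^ s = ρ⁻¹ := by
    rw [Real.rpow_def_of_pos hc0, hs, mul_div_cancel₀ _ hlogc.ne', Real.exp_neg, Real.exp_log hρ0]
  set a : ℝ := c ^ k with ha
  have ha0 : 0 < a := zpow_pos hc0 k
  have hale : a ≤ ρ⁻¹ := by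
    rw [ha, ← Real.rpow_intCast, ← hcs]
    exact Real.rpow_le_rpow_of_exponent_le hc.le (Int.floor_le s)
  have halo : c⁻¹ ≤ a * ρ := by
    have h1 : c ^ s < c ^ ((k : ℝ) + 1) := Real.rpow_lt_rpow_of_exponent_lt hc (Int.lt_floor_add_one s)
    rw [hcs, Real.rpow_add hc0, Real.rpow_intCast, Real.rpow_one] at h1
    -- `ρ⁻¹ < a * c`, i.e. `c⁻¹ < a ρ`
    have h2 : c⁻¹ < a * ρ := by
      have h3 : ρ⁻¹ * ρ < a * c * ρ := mul_lt_mul_of_pos_right h1 hρ0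
      rw [inv_mul_cancel₀ hρ0.ne'] at h3
      have h4 : c⁻¹ * 1 < c⁻¹ * (a * c * ρ) := mul_lt_mul_of_pos_left h3 (inv_pos.2 hc0)
      calc c⁻¹ = c⁻¹ * 1 := (mul_one _).symm
        _ < c⁻¹ * (a * c * ρ) := h4
        _ = a * ρ := by field_simp
    exact h2.le
  have hahi : a * ρ ≤ 1 := by
    calc a * ρ ≤ ρ⁻¹ * ρ := mul_le_mul_of_nonneg_right hale hρ0.le
      _ = 1 := inv_mul_cancel₀ hρ0.ne'
  -- `U(t,x) = a U(a² t, a x)` and the rescaled point lies in the fundamental domain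
  have key := pastDss_zpow hc0 h k t ht x
  rw [nsRescale_apply] at key
  have hden : ‖a • x‖ + Real.sqrt (-(a ^ 2 * t)) = a * ρ := by
    rw [norm_smul, Real.norm_of_nonneg ha0.le, show -(a ^ 2 * t) = a ^ 2 * (-t) by ring,
      Real.sqrt_mul' _ (neg_pos.2 ht).le, Real.sqrt_sq ha0.le, hρ]
    ring
  have hb := hD (a ^ 2 * t) (mul_neg_of_pos_of_neg (by positivity) ht) (a • x) (hden ▸ halo) (hden ▸ hahi)
  rw [← ha] at key
  rw [← key, norm_smul, Real.norm_of_nonneg ha0.le]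
  calc a * ‖n.U (a ^ 2 * t) (a • x)‖ ≤ ρ⁻¹ * Bm := mul_le_mul hale hb (norm_nonneg _) (inv_nonneg.2 hρ0.le)
    _ = Bm / ρ := by rw [div_eq_inv_mul]

/-- ★★ **THE DSS CELL SPLITS CLEANLY: TAME ⟺ LEAF ⟺ ENVELOPED, WILD ⟺ NECKLACE.**  For a rooted A–B object
exactly past-DSS with a factor `c > 1`: it is tame at the root iff it is a leaf iff it is globally enveloped;
it is wild iff it carries a satellite `y ≠ 0` — and then the whole necklace `{c^k y : k ∈ ℤ}` of satellites,
accumulating at the root and escaping to infinity. -/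
theorem pastDss_cell {n : TNode} (hT : ABTower M n.U n.P n.H) {c : ℝ} (hc : 1 < c)
    (h : ∀ t < 0, ∀ x, nsRescale c n.U t x = n.U t x) :
    (TameRoot n ↔ LeafNode n) ∧ (TameRoot n ↔ ∃ A : ℝ, HasTypeIDecay A n.U) ∧
      (¬ TameRoot n ↔ ∃ y : (EuclideanSpace ℝ (Fin 3)), y ≠ 0 ∧ ¬ RegPt n.U y) ∧
      (∀ y : (EuclideanSpace ℝ (Fin 3)), ¬ RegPt n.U y → ∀ k : ℤ, ¬ RegPt n.U ((c ^ k) • y)) := by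
  have h2 := tameRoot_iff_hasTypeIDecay_of_pastDss hT hc h
  have h1 : TameRoot n ↔ LeafNode n := by
    constructor
    · intro ht y hy _
      obtain ⟨A, hA⟩ := h2.1 ht
      exact regPt_of_hasTypeIDecay hA hy
    · intro hl
      exact h2.2 (hasTypeIDecay_of_pastDss_leaf hT hc h hl)
  refine ⟨h1, h2, ?_, fun y hy k => necklace_of_pastDss_satellite hc h hy k⟩
  rw [h1]
  constructor
  · intro hl
    by_contra hcon
    push Not at hcon
    exact hl fun y hy _ => hcon y hy
  · rintro ⟨y, hy, hny⟩ hl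
    exact hny (regPt_of_pastDss_leaf hc h hl hy)

end HullJunction

end Summit.NavierStokesRegularity.NavierStokesRegularity.Cruxes.ScarEnvelopeTypeI.ZoomDictionary
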